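import Mathlib
import Summits.QuantumFields.QCD.Theorems.QuarksAsStableActionUnquenchedChessboardBoundStubSitePeelMask
import HarnessLib

/-!
# The bond-diluted, polarised Gram identity, II: masked blocks and the identity (stubs
`stub_torusPeel` / `stub_sitePeel` of crux stmt-QuantumFields-9735, line Sketch — wave-2 helper 1b)

With the site mask `w_E` and the reflected bond set `θE` of helper 1a: the masked upper and plane
blocks `P_E = w_E ⊙ P`, `C_E = w_E ⊙ C`, the diluted kernel `K_E = Γ(C_E)ᵀ ⊗ Γ(C_E)`, the block form
of `det (w_E ⊙ D'[U])` (the lower block is the mirror of the `θE`-masked upper block of the reflected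
field, by `bondMask_siteTimeNeg`), and **the diluted Gram identity** `det_bondWilsonDiracAP_eq_gram`:
`det D_E[U] = Σ_{IJ} K_E(U)_{IJ} ρ_I(P_E(U)) conj ρ_J(P_{θE}(Θ'U))` — polarised by construction.
-/

noncomputable section

open Matrix Complex Finset
open Literature.MathematicalPhysics.QuantumLattice Literature.MathematicalPhysics.QuantumFieldTheory
open Literature.Probability.LatticeModels
open Summit.QuantumFields.QCD.Theorems.QuarksAsStableAction
open scoped ComplexConjugate BigOperators Kronecker

namespace Summit.QuantumFields.QCD.Theorems.UnquenchedChessboardBoundLine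

/-! ## The masked blocks and the diluted Gram identity -/

section Blocks

variable {L N : ℕ} [NeZero L] [Fact (1 < L)]

/-- The masked upper block `P_E(U)_{ij} = w_E(xᵢ, xⱼ) P(U)_{ij}`. -/
def upperBlockE (E : Finset (Edge 4 L)) (U : GaugeConfig 4 L (Matrix.specialUnitaryGroup (Fin N) ℂ)) (m : ℝ) :
    Matrix (Fin (upCard L N)) (Fin (upCard L N)) ℂ :=
  Matrix.of fun i j => bondMask E (upEnum L N i).1 (upEnum L N j).1 * upperBlock U m i j

/-- The masked plane block `C_E(U)_{ij} = w_E(xᵢ, xⱼ) C(U)_{ij}`. -/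
def planeBlockE (E : Finset (Edge 4 L)) (U : GaugeConfig 4 L (Matrix.specialUnitaryGroup (Fin N) ℂ)) (m : ℝ) :
    Matrix (Fin (upCard L N)) (Fin (upCard L N)) ℂ :=
  Matrix.of fun i j => bondMask E (upEnum L N i).1 (upEnum L N j).1 * planeBlock U m i j

/-- The diluted Gram kernel `K_E(U) = Γ(C_E(U))ᵀ ⊗ Γ(C_E(U))`. -/
def gramKernelE (E : Finset (Edge 4 L)) (U : GaugeConfig 4 L (Matrix.specialUnitaryGroup (Fin N) ℂ)) (m : ℝ) :
    Matrix (Finset (Fin (upCard L N)) × Finset (Fin (upCard L N)))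
      (Finset (Fin (upCard L N)) × Finset (Fin (upCard L N))) ℂ :=
  (Gamma (planeBlockE E U m))ᵀ ⊗ₖ Gamma (planeBlockE E U m)

omit [Fact (1 < L)] in
/-- Masked upper blocks of bond sets with the same bonds between upper sites agree. -/
theorem upperBlockE_congr {E E' : Finset (Edge 4 L)}
    (h : ∀ x y : TorusSite 4 L, tv x ≤ L / 2 → tv y ≤ L / 2 → bondMask E x y = bondMask E' x y)
    (U : GaugeConfig 4 L (Matrix.specialUnitaryGroup (Fin N) ℂ)) (m : ℝ) : upperBlockE E U m = upperBlockE E' U m := by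
  ext i j
  simp only [upperBlockE, Matrix.of_apply]
  have hi := mem_upIdx.1 (upEnum_mem (L := L) (N := N) i)
  have hj := mem_upIdx.1 (upEnum_mem (L := L) (N := N) j)
  rw [h _ _ (by omega) (by omega)]

omit [Fact (1 < L)] in
/-- Masked plane blocks of bond sets with the same bonds between plane sites agree. -/
theorem planeBlockE_congr {E E' : Finset (Edge 4 L)}
    (h : ∀ x y : TorusSite 4 L, (tv x = 0 ∨ tv x = L / 2) → (tv y = 0 ∨ tv y = L / 2) → bondMask E x y = bondMask E' x y)
    (U : GaugeConfig 4 L (Matrix.specialUnitaryGroup (Fin N) ℂ)) (m : ℝ) : planeBlockE E U m = planeBlockE E' U m := by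
  ext i j
  simp only [planeBlockE, planeBlock, Matrix.of_apply]
  split_ifs with hp
  · rw [h _ _ (mem_planeIdx.1 hp.1) (mem_planeIdx.1 hp.2)]
  · rw [mul_zero, mul_zero]

/-- **The block form of the diluted determinant** (masked form):
`det (w_E ⊙ D'[U]) = det [[P_E(U), C_E(U)], [C_E(U), diag v · P_{θE}(Θ'U)ᴴ · diag u]]`. -/
theorem det_maskMul_eq_det_fromBlocks (hL : Even L) (h4 : 4 ≤ L) (E : Finset (Edge 4 L))
    (U : GaugeConfig 4 L (Matrix.specialUnitaryGroup (Fin N) ℂ)) (m : ℝ) :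
    (maskMul E (wilsonDiracG (unitaryFundamentalRep (Fin N) ℂ) chiralGamma (apLift U) m 1)).det =
      (fromBlocks (upperBlockE E U m) (planeBlockE E U m) (planeBlockE E U m)
        (diagonal (vVec L N) * (upperBlockE (reflBonds E) (GaugeConfig.negReflect U) m)ᴴ * diagonal (uVec L N))).det := by
  set D := maskMul E (wilsonDiracG (unitaryFundamentalRep (Fin N) ℂ) chiralGamma (apLift U) m 1) with hD
  have h2 : D.det = (D.submatrix (blockEquiv hL h4) (piPerm ∘ blockEquiv hL h4)).det := by
    rw [show D.submatrix (blockEquiv hL h4) (piPerm ∘ blockEquiv hL h4) =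
      (D.submatrix id piPerm).submatrix (blockEquiv hL h4) (blockEquiv hL h4) by rfl,
      det_submatrix_equiv_self, det_permute', sign_piPerm, Units.val_one, Int.cast_one, one_mul]
  rw [h2]
  congr 1
  ext (i | i) (j | j) <;>
    simp only [Matrix.submatrix_apply, Function.comp_apply, fromBlocks_apply₁₁, fromBlocks_apply₁₂,
      fromBlocks_apply₂₁, fromBlocks_apply₂₂, blockEquiv, Equiv.coe_fn_mk, Sum.elim_inl, Sum.elim_inr, piPerm,
      Function.Involutive.coe_toPerm]
  · simp only [hD, maskMul, upperBlockE, upperBlock, Matrix.of_apply, piMap_fst]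
  · rw [piMap_sigmaMap hL, piMap_piMap, hD]
    simp only [maskMul, Matrix.of_apply, planeBlockE, planeBlock,
      crossBlock₁_entry _ hL h4 _ m (upEnum_mem i) (upEnum_mem j)]
    split_ifs with hp
    · rw [sigmaMap_of_mem_planeIdx hL hp.2]
    · rw [mul_zero, mul_zero]
  · rw [hD]
    simp only [maskMul, Matrix.of_apply, planeBlockE, planeBlock,
      crossBlock₂_entry _ hL h4 _ m (upEnum_mem i) (upEnum_mem j), piMap_fst]
    split_ifs with hp
    · have : sigmaMap (piMap (upEnum L N i)) = piMap (upEnum L N i) :=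
        sigmaMap_of_mem_planeIdx hL (by rw [mem_planeIdx, piMap_fst]; exact mem_planeIdx.1 hp.1)
      rw [this, piMap_fst]
    · rw [mul_zero, mul_zero]
  · rw [piMap_sigmaMap hL, piMap_piMap, hD]
    simp only [maskMul, Matrix.of_apply]
    rw [lowerBlock_entry, mul_diagonal, diagonal_mul, conjTranspose_apply, ← starRingEnd_apply]
    simp only [vVec, uVec, upperBlockE, upperBlock, Matrix.of_apply, map_mul, conj_bondMask]
    rw [show (sigmaMap (piMap (upEnum L N i))).1 = siteTimeNeg (upEnum L N i).1 by simp only [sigmaMap, piMap_fst],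
      show (sigmaMap (upEnum L N j)).1 = siteTimeNeg (upEnum L N j).1 from rfl, bondMask_siteTimeNeg, bondMask_comm]
    ring

omit [Fact (1 < L)] in
/-- A minor of the masked plane block with a row or a column off the planes vanishes. -/
theorem Gamma_planeBlockE_eq_zero (E : Finset (Edge 4 L)) (U : GaugeConfig 4 L (Matrix.specialUnitaryGroup (Fin N) ℂ)) (m : ℝ)
    {W S : Finset (Fin (upCard L N))} (h : ¬ (W ⊆ planeFin L N ∧ S ⊆ planeFin L N)) :
    Gamma (planeBlockE E U m) W S = 0 := by
  by_cases hc : W.card = S.card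
  · rw [Gamma_apply_of_card_eq _ (k := S.card) hc rfl]
    rcases not_and_or.1 h with hW | hS
    · obtain ⟨w, hwW, hw⟩ := Finset.not_subset.1 hW
      have hw' : upEnum L N w ∉ planeIdx := fun h' => hw (by simp [planeFin, h'])
      refine det_eq_zero_of_row_eq_zero ((W.orderIsoOfFin hc).symm ⟨w, hwW⟩) fun b => ?_
      have : W.orderEmbOfFin hc ((W.orderIsoOfFin hc).symm ⟨w, hwW⟩) = w := by
        rw [← Finset.coe_orderIsoOfFin_apply, OrderIso.apply_symm_apply]
      rw [submatrix_apply, this, planeBlockE, Matrix.of_apply, planeBlock, Matrix.of_apply,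
        if_neg (fun h' => hw' h'.1), mul_zero]
    · obtain ⟨s, hsS, hs⟩ := Finset.not_subset.1 hS
      have hs' : upEnum L N s ∉ planeIdx := fun h' => hs (by simp [planeFin, h'])
      refine det_eq_zero_of_column_eq_zero ((S.orderIsoOfFin rfl).symm ⟨s, hsS⟩) fun a => ?_
      have : S.orderEmbOfFin rfl ((S.orderIsoOfFin rfl).symm ⟨s, hsS⟩) = s := by
        rw [← Finset.coe_orderIsoOfFin_apply, OrderIso.apply_symm_apply]
      rw [submatrix_apply, this, planeBlockE, Matrix.of_apply, planeBlock, Matrix.of_apply,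
        if_neg (fun h' => hs' h'.2), mul_zero]
  · exact Gamma_apply_of_card_ne _ hc

omit [Fact (1 < L)] in
/-- **The reflected term** for a general upper block `P`: for `S, T` on the planes with `|S| = |T|`,
`(-1)^{|S|} ρ(diag v Pᴴ diag u)_{S,T} = conj ρ(P)_{T,S}`. -/
theorem neg_pow_mul_rho_lower (hL : Even L) (h4 : 4 ≤ L) (P : Matrix (Fin (upCard L N)) (Fin (upCard L N)) ℂ)
    {S T : Finset (Fin (upCard L N))} (hS : S ⊆ planeFin L N) (hT : T ⊆ planeFin L N) (hc : S.card = T.card) :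
    (-1) ^ S.card * rho (diagonal (vVec L N) * Pᴴ * diagonal (uVec L N)) S T = conj (rho P T S) := by
  have hv : ∀ i, vVec L N i ≠ 0 := fun i => by
    unfold vVec vPhase timeSign
    refine mul_ne_zero (by split_ifs <;> norm_num) ?_
    rw [map_ne_zero_iff _ (RingHom.injective _)]
    generalize (piMap (upEnum L N i)).2.2 = α
    fin_cases α <;> simp [chi]
  have hu : ∀ i, uVec L N i ≠ 0 := fun i => by
    unfold uVec uPhase timeSign
    refine mul_ne_zero (by split_ifs <;> norm_num) ?_
    generalize (upEnum L N i).2.2 = α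
    fin_cases α <;> simp [chi]
  rw [rho_diagonal_mul_mul_diagonal _ _ hv hu, prod_vVec_mul_uVec hL h4, one_mul, rho_conjTranspose]
  have h1 : ∏ s ∈ S, (uVec L N s)⁻¹ = I ^ S.card := by
    rw [Finset.prod_congr rfl fun s hs => by rw [(vVec_uVec_of_mem hL h4 (hS hs)).2], Finset.prod_const]
    congr 1
    rw [inv_eq_iff_eq_inv]; simp
  have h2 : ∏ t ∈ T, (vVec L N t)⁻¹ = I ^ T.card := by
    rw [Finset.prod_congr rfl fun t ht => by rw [(vVec_uVec_of_mem hL h4 (hT ht)).1], Finset.prod_const]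
    congr 1
    rw [inv_eq_iff_eq_inv]; simp
  rw [h1, h2, ← hc, ← mul_assoc, ← mul_assoc, ← mul_pow, ← mul_pow,
    show (-1 : ℂ) * I * I = 1 by rw [mul_assoc, Complex.I_mul_I]; norm_num, one_pow, one_mul]

/-- The diluted Gram identity, masked form. -/
theorem det_maskMul_eq_gram (hL : Even L) (h4 : 4 ≤ L) (E : Finset (Edge 4 L))
    (U : GaugeConfig 4 L (Matrix.specialUnitaryGroup (Fin N) ℂ)) (m : ℝ) :
    (maskMul E (wilsonDiracG (unitaryFundamentalRep (Fin N) ℂ) chiralGamma (apLift U) m 1)).det =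
      ∑ I : Finset (Fin (upCard L N)) × Finset (Fin (upCard L N)),
        ∑ J : Finset (Fin (upCard L N)) × Finset (Fin (upCard L N)),
          gramKernelE E U m I J * rho (upperBlockE E U m) I.1 I.2 *
            conj (rho (upperBlockE (reflBonds E) (GaugeConfig.negReflect U) m) J.1 J.2) := by
  rw [det_maskMul_eq_det_fromBlocks hL h4, det_fromBlocks_eq_sum_rho]
  simp only [Fintype.sum_prod_type]
  conv_lhs => rw [Finset.sum_comm]
  conv_lhs => arg 2; ext W; rw [Finset.sum_comm]
  conv_lhs => arg 2; ext W; arg 2; ext Z; rw [Finset.sum_comm]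
  rw [Finset.sum_comm]
  refine Finset.sum_congr rfl fun Z _ => Finset.sum_congr rfl fun W _ =>
    Finset.sum_congr rfl fun T _ => Finset.sum_congr rfl fun S _ => ?_
  simp only [gramKernelE, Matrix.kroneckerMap_apply, Matrix.transpose_apply]
  by_cases hWS : W ⊆ planeFin L N ∧ S ⊆ planeFin L N
  swap
  · rw [Gamma_planeBlockE_eq_zero E U m hWS]; ring
  by_cases hTZ : T ⊆ planeFin L N ∧ Z ⊆ planeFin L N
  swap
  · rw [Gamma_planeBlockE_eq_zero E U m hTZ]; ring
  by_cases hc : S.card = T.card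
  swap
  · rw [rho_of_card_ne hc, rho_of_card_ne (Ne.symm hc), map_zero]; ring
  rw [neg_pow_mul_rho_lower hL h4 _ hWS.2 hTZ.1 hc]
  ring

end Blocks

/-- **The diluted Gram identity.** For every bond set `E`, the bond-diluted antiperiodic Wilson
fermion determinant is the kernel pairing of the row-replacement minors of the `E`-masked upper
block of `U` with the conjugates of those of the `θE`-masked upper block of the reflected field. -/
theorem det_bondWilsonDiracAP_eq_gram {L N : ℕ} [NeZero L] [Fact (1 < L)] (hL : Even L) (h4 : 4 ≤ L)
    (E : Finset (Edge 4 L)) (U : GaugeConfig 4 L (Matrix.specialUnitaryGroup (Fin N) ℂ)) (m : ℝ) :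
    (bondWilsonDiracAP E U m).det =
      ∑ I : Finset (Fin (upCard L N)) × Finset (Fin (upCard L N)),
        ∑ J : Finset (Fin (upCard L N)) × Finset (Fin (upCard L N)),
          gramKernelE E U m I J * rho (upperBlockE E U m) I.1 I.2 *
            conj (rho (upperBlockE (reflBonds E) (GaugeConfig.negReflect U) m) J.1 J.2) := by
  rw [bondWilsonDiracAP, bondWilsonDirac_eq_maskMul h4, ← det_maskMul_wilsonDiracG_chiral,
    det_maskMul_eq_gram hL h4]

end Summit.QuantumFields.QCD.Theorems.UnquenchedChessboardBoundLine

end
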